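import Summits.HubbardSuperconductivity.HubbardSuperconductivity.Theorems.AnisotropyChordTransferFibre3FinXDCheck

/-!
# Route `AnisotropyChord` / H0 rotor rung: FIN per-`L` row-D (KT-2a″) cell facts, `L = 12`, cells 132–135

Kernel facts `xdCellAny0 12 (49/50) la lb aD = true` (in-kernel point tables, zero data; `decide +kernel`) for the combined-cell
grid of `L = 12` (g5 design, 1–2.5 % cells); assembled in `…FinXDTwelve`.  Prover seat `hubbard-h0-rotor-p3` g7; helper for piece A =
stmt-HubbardSuperconductivity-23918 of rung 19089 (`--supports`, helper class).  WHAT THIS IS NOT: nothing here proves superconductivity in the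
Hubbard model (rotor TARGET as worded stays FALSE, g15 verdict); kernel facts for ONE hypothesis of ONE conditional reduction.  No sorry.
-/

set_option linter.dupNamespace false
set_option autoImplicit false

namespace Summit.HubbardSuperconductivity.HubbardSuperconductivity.Theorems.AnisotropyChord.Transfer.Fibre3

namespace FinXD

/-- cell 132 of `L = 12` (`cert`). [folklore] -/
theorem xd12_132 : xdCellAny0 12 (49/50 : ℚ) 10312297146569591 10570104575233831 (7/100 : ℚ) = true := by decide +kernel

/-- cell 133 of `L = 12` (`cert`). [folklore] -/
theorem xd12_133 : xdCellAny0 12 (49/50 : ℚ) 10570104575233831 10834357189614677 (7/100 : ℚ) = true := by decide +kernel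

/-- cell 134 of `L = 12` (`cert`). [folklore] -/
theorem xd12_134 : xdCellAny0 12 (49/50 : ℚ) 10834357189614677 11105216119355043 (7/100 : ℚ) = true := by decide +kernel

/-- cell 135 of `L = 12` (`cert`). [folklore] -/
theorem xd12_135 : xdCellAny0 12 (49/50 : ℚ) 11105216119355043 11382846522338921 (7/100 : ℚ) = true := by decide +kernel

end FinXD

end Summit.HubbardSuperconductivity.HubbardSuperconductivity.Theorems.AnisotropyChord.Transfer.Fibre3
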